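import Mathlib
import Summits.Ventures.HodgeRepro.Tier4.Common.AdelicDefs
import Summits.Ventures.HodgeRepro.Tier4.Line1.PlaneDefs
import Summits.Ventures.HodgeRepro.Tier4.Line1.C7Components
import Summits.Ventures.HodgeRepro.Tier4.Line1.C7Reconstruct
import Summits.Ventures.HodgeRepro.Tier4.Line1.LocalFieldTopology

/-!
# Tier4/Line1/C7LocalWitt — C7.1 and C7.1∞ (the local fibrations) modulo LOCAL WITT, displayed

Blind re-derivation cell `pub-hodge-repro`, Tier 4 (README §9–§10), seat t4-L1-p2 (prover, LINE L1, gen 0).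
The two local-fibration walls of t4-L1-p4's C7 census (`proofs/t4/L1/C7-rungs-sig.lean` L115–L134: C7.1 at a finite
place, C7.1∞ at an infinite place) with their ONE printed input DISPLAYED as a hypothesis: local Witt — the local
unitary group is transitive on the sphere of `v₀` (`hwitt`).  Everything else is a theorem on the tree: t4-L1-p1's
`exists_compact_stab_mul_of_transitive` (LocalFibration p672938: Mathlib's open-mapping theorem
`isOpenMap_smul_of_sigmaCompact` for the closed unitary subgroup of `GL₄(k_v)` acting on the sphere, and the lift of a
compact subset of the orbit to a compact subset of the group), p1's local-field topology (LocalFieldTopology p673209: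
`k_v` locally compact and σ-compact, `k_w` σ-compact), and `det B ≠ 0` from `IsDefinite` (C7Reconstruct p673045).
The conclusions are p4's C7.1 / C7.1∞ VERBATIM; p4's assembly C7.4 closes C7 from these two and C7.2.
HC_CM is NOT proved by anyone in this repository.
-/

set_option autoImplicit false

noncomputable section

namespace Summit.Ventures.HodgeRepro.Tier4.Line1

open NumberField IsDedekindDomain HeightOneSpectrum Topology Common Matrix

section LocalWitt

variable {k : Type} [Field k] [NumberField k] (W : PlaneData k)

omit [NumberField k] in
/-- `B` read in a field extension of `k` is invertible when the plane is definite -/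
theorem isUnit_map_B_of_isDefinite (hW : IsDefinite W) {F : Type*} [Field F] (φ : k →+* F) :
    IsUnit (W.B.map φ) := by
  rw [Matrix.isUnit_iff_isUnit_det, ← RingHom.mapMatrix_apply, ← RingHom.map_det]
  exact isUnit_iff_ne_zero.2 ((map_ne_zero φ).2 (det_B_ne_zero_of_isDefinite W hW))

/-- **(C7.1 modulo local Witt) LOCAL FIBRATION AT A FINITE PLACE**: if `U(W)(k_v)` is transitive on the sphere of
`v₀` (`hwitt`, the printed input: Witt's theorem for the hermitian plane over `E′_v`), then for every compact
`C ⊆ k_v⁴` the set `{h ∈ U(W)(k_v) : v₀ h ∈ C}` lies in `Stab_v(v₀) · K` with `K` compact (the conclusion is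
t4-L1-p4's `exists_compact_local_stab_mul_fin`, C7-rungs-sig.lean L115–L121, verbatim). -/
theorem exists_compact_local_stab_mul_fin_of_witt (hW : IsDefinite W)
    (v : HeightOneSpectrum (𝓞 k)) (v₀ : Fin 4 → k)
    (hwitt : ∀ x : Fin 4 → v.adicCompletion k,
      x ᵥ* W.B.map (algebraMap k (v.adicCompletion k)) ⬝ᵥ x =
        finRat v v₀ ᵥ* W.B.map (algebraMap k (v.adicCompletion k)) ⬝ᵥ finRat v v₀ →
      (x ᵥ* W.Ω.map (algebraMap k (v.adicCompletion k))) ᵥ* W.B.map (algebraMap k (v.adicCompletion k)) ⬝ᵥ x =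
        (finRat v v₀ ᵥ* W.Ω.map (algebraMap k (v.adicCompletion k))) ᵥ*
          W.B.map (algebraMap k (v.adicCompletion k)) ⬝ᵥ finRat v v₀ →
      ∃ h ∈ localU W v, finRat v v₀ ᵥ* h = x)
    {C : Set (Fin 4 → v.adicCompletion k)} (hC : IsCompact C) :
    ∃ K : Set (Matrix (Fin 4) (Fin 4) (v.adicCompletion k)), IsCompact K ∧
      ∀ h ∈ localU W v, finRat v v₀ ᵥ* h ∈ C →
        ∃ s ∈ localU W v, finRat v v₀ ᵥ* s = finRat v v₀ ∧ ∃ κ ∈ localU W v, κ ∈ K ∧ h = s * κ := by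
  haveI := locallyCompactSpace_adicCompletion k v
  haveI := sigmaCompactSpace_adicCompletion k v
  obtain ⟨K, hK, hmain⟩ := exists_compact_stab_mul_of_transitive
    (W.B.map (algebraMap k (v.adicCompletion k))) (W.Ω.map (algebraMap k (v.adicCompletion k)))
    (isUnit_map_B_of_isDefinite W hW _) (finRat v v₀)
    (fun x h1 h2 => by
      obtain ⟨h, hh, hx⟩ := hwitt x h1 h2
      exact ⟨h, hh, hx⟩) hC
  refine ⟨K, hK, fun h hh hhC => ?_⟩
  obtain ⟨s, hs, hsv, κ, hκ, hκK, hsκ⟩ := hmain h hh hhC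
  exact ⟨s, hs, hsv, κ, hκ, hκK, hsκ⟩

omit [NumberField k] in
/-- **(C7.1∞ modulo local Witt) LOCAL FIBRATION AT AN INFINITE PLACE**: the same over `k_w` (the conclusion is
t4-L1-p4's `exists_compact_local_stab_mul_inf`, C7-rungs-sig.lean L125–L134, verbatim). -/
theorem exists_compact_local_stab_mul_inf_of_witt (hW : IsDefinite W)
    (w : InfinitePlace k) (v₀ : Fin 4 → k)
    (hwitt : ∀ x : Fin 4 → w.Completion,
      x ᵥ* W.B.map (algebraMap k w.Completion) ⬝ᵥ x =
        infRat w v₀ ᵥ* W.B.map (algebraMap k w.Completion) ⬝ᵥ infRat w v₀ →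
      (x ᵥ* W.Ω.map (algebraMap k w.Completion)) ᵥ* W.B.map (algebraMap k w.Completion) ⬝ᵥ x =
        (infRat w v₀ ᵥ* W.Ω.map (algebraMap k w.Completion)) ᵥ*
          W.B.map (algebraMap k w.Completion) ⬝ᵥ infRat w v₀ →
      ∃ h ∈ localUInf W w, infRat w v₀ ᵥ* h = x)
    {C : Set (Fin 4 → w.Completion)} (hC : IsCompact C) :
    ∃ K : Set (Matrix (Fin 4) (Fin 4) w.Completion), IsCompact K ∧
      ∀ h ∈ localUInf W w, infRat w v₀ ᵥ* h ∈ C →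
        ∃ s ∈ localUInf W w, infRat w v₀ ᵥ* s = infRat w v₀ ∧
          ∃ κ ∈ localUInf W w, κ ∈ K ∧ h = s * κ := by
  haveI := sigmaCompactSpace_infinitePlaceCompletion k w
  obtain ⟨K, hK, hmain⟩ := exists_compact_stab_mul_of_transitive
    (W.B.map (algebraMap k w.Completion)) (W.Ω.map (algebraMap k w.Completion))
    (isUnit_map_B_of_isDefinite W hW _) (infRat w v₀)
    (fun x h1 h2 => by
      obtain ⟨h, hh, hx⟩ := hwitt x h1 h2
      exact ⟨h, hh, hx⟩) hC
  refine ⟨K, hK, fun h hh hhC => ?_⟩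
  obtain ⟨s, hs, hsv, κ, hκ, hκK, hsκ⟩ := hmain h hh hhC
  exact ⟨s, hs, hsv, κ, hκ, hκK, hsκ⟩

end LocalWitt

end Summit.Ventures.HodgeRepro.Tier4.Line1

end
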